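import Literature.Probability.Percolation.TriUQuadFencePieces
import HarnessLib

/-!
# Fence routes, step by step: continuation lemmas and arc bookkeeping

Topic `Literature/Probability/Percolation`; family `crit-perc`, statement **crit-perc.S16**
(`Literature.Probability.Percolation.triTheta_exponent`). Small tools for the fence step of
Kesten's arm separation in the U-shaped half-plane region `U_{k,N}` (P. Nolin, EJP 13 (2008),
§4.2 Def. 6, §4.4 proof of Lemma 15 [arXiv 0711.4948: Def. 6, Lemma 14]), on top of the two kinds
of pieces of `TriUQuadFencePieces.lean`:

* `uStepA`, `uStepB` — **continuation steps**: walking one more crossing of the frame (kind A,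
  resp. kind B) from the current junction either produces the goal (an `ω`-open path of `U ∪ I`
  from the start of the fence to a site of the crossing `S`), or extends the accumulated really
  open path to the next junction and certifies that the junction is inside `I` or high (kind A),
  resp. high (kind B). A route is then a chain of steps ending at a site which is NOT high (a
  site of `I`, or a fake site below the real line): the last alternative is contradictory, so the
  goal holds — no case analysis on where `S` meets the frame is needed.
* `uB_subset_uLow_union`, `not_uLow_of_mem_uT` — the left real segment is low or on `S`; the
  right real segment is never low (the quad's `meet` property: a `B–T` path of `U ∖ S` would miss
  the `L–R` path `S`).
* `uHt_of_top`, `beyond_top`, `beyond_left`, `beyond_right` — the arc sites beyond a tip on the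
  top side / left side / right side of the inner arc, in coordinates.
* `mem_uSites_or_uInner` — sites of the closed half-box `[-N, N] × [0, N]` are in `U` or in `I`.

## References

* P. Nolin, Near-critical percolation in two dimensions, *Electron. J. Probab.* 13 (2008), §4.2
  Def. 6, §4.4 proof of Lemma 15 [arXiv 0711.4948: Def. 6, Lemma 14] [Nolin2008].
* H. Kesten, Scaling relations for 2D-percolation, *Comm. Math. Phys.* 109 (1987), Lemma 2
  [KestenScalingCMP1987].

## Mathlib / tree

Tree: `uPiece_beyond`, `uPiece_high`, `pieceA_subset_open`, `pieceB_subset_open`, `uHigh`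
(`TriUQuadFencePieces.lean`), `uLow`, `uLow_subset` (`TriUQuadFence.lean`), `uHt`, `mem_uL_iff`
(`TriUQuadArc.lean`), `uQuad` (its `meet` field), `uB_subset`, `uT_subset`, `mem_coe_uSites`
(`TriUQuad.lean`).
-/

noncomputable section

open Set

namespace Literature.Probability.Percolation

open LatticeModels

variable {k N : ℕ}

/-! ### Small bookkeeping lemmas -/

/-- Sites of the closed half-box `[-N, N] × [0, N]` lie in `U` or in the inner box `I`. [folklore] -/
theorem mem_uSites_or_uInner {z : Site 2} (h0 : -(N : ℤ) ≤ z 0) (h0' : z 0 ≤ N) (h1 : 0 ≤ z 1)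
    (h1' : z 1 ≤ N) : z ∈ (↑(uSites k N) : Set (Site 2)) ∨ z ∈ uInner k := by
  by_cases h : z ∈ uInner k
  · exact Or.inr h
  · exact Or.inl (mem_coe_uSites.2 ⟨⟨h0, h0', h1, h1'⟩, h⟩)

/-- The left real segment is low or on the crossing. [folklore] -/
theorem uB_subset_uLow_union (hk : 1 ≤ k) (S : Set (Site 2)) : uB k N ⊆ uLow k N S ∪ S := by
  intro b hb
  by_cases hbS : b ∈ S
  · exact Or.inr hbS
  · exact Or.inl ⟨b, hb, PathIn.refl ⟨uB_subset hk hb, hbS⟩⟩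

/-- **The right real segment is never low**: a path of `U ∖ S` from the left segment to the right
segment would miss the inner–outer crossing inside `S` (the quad's `meet` property). [cite: Nolin2008, §4.4 (U-shaped regions)] [cite: KestenPTM1982, §2.2 (paths crossing a rectangle must intersect)] -/
theorem not_uLow_of_mem_uT (hk : 1 ≤ k) (hkN : k + 1 ≤ N) {S : Set (Site 2)} {l y : Site 2}
    (hSU : S ⊆ ↑(uSites k N)) (hl : l ∈ uL k N) (hy : y ∈ uR k N) (hpγ : PathIn triGraph S l y)
    {d : Site 2} (hd : d ∈ uT k N) : d ∉ uLow k N S := by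
  rintro ⟨b, hb, hp⟩
  obtain ⟨z, hzS, hz⟩ := (uQuad k N hk hkN).meet hSU (fun _ h => h.1) hl hy hpγ hb hd hp
  exact hz.2 hzS

/-- The arc parameter of a top-side tip. [folklore] -/
theorem uHt_of_top {l : Site 2} (hl1 : l 1 = k) : uHt k l = 2 * k + l 0 := by
  unfold uHt; split_ifs <;> omega

/-- **Arc sites beyond a top-side tip**: top-row sites to its right, and the right column. [folklore] -/
theorem beyond_top (hk : 1 ≤ k) (hkN : k + 1 ≤ N) {l a : Site 2} (hl : l ∈ uL k N) (hl1 : l 1 = k)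
    (ha : a ∈ uL k N) (hlt : uHt k l < uHt k a) :
    (a 1 = k ∧ l 0 + 1 ≤ a 0 ∧ a 0 ≤ k - 1) ∨ (a 0 = k ∧ 0 ≤ a 1 ∧ a 1 ≤ k - 1) := by
  rw [uHt_of_top hl1] at hlt
  rw [mem_uL_iff hk hkN] at ha hl
  unfold uHt at hlt; split_ifs at hlt <;> omega

/-- **Arc sites beyond a left-side tip**: the left column above it, the top row, the right column. [folklore] -/
theorem beyond_left (hk : 1 ≤ k) (hkN : k + 1 ≤ N) {l a : Site 2} (hl0 : l 0 = -(k : ℤ))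
    (ha : a ∈ uL k N) (hlt : uHt k l < uHt k a) :
    (a 0 = -(k : ℤ) ∧ l 1 + 1 ≤ a 1 ∧ a 1 ≤ k) ∨ (a 1 = k ∧ -(k : ℤ) + 1 ≤ a 0 ∧ a 0 ≤ k - 1) ∨
      (a 0 = k ∧ 0 ≤ a 1 ∧ a 1 ≤ k - 1) := by
  have hk' : (1 : ℤ) ≤ k := by exact_mod_cast hk
  have : uHt k l = l 1 := by unfold uHt; rw [if_pos hl0]
  rw [this] at hlt
  rw [mem_uL_iff hk hkN] at ha
  unfold uHt at hlt; split_ifs at hlt <;> omega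

/-- **Arc sites beyond a right-side tip**: the right column below it. [folklore] -/
theorem beyond_right (hk : 1 ≤ k) (hkN : k + 1 ≤ N) {l a : Site 2} (hl0 : l 0 = k) (hl1 : l 1 ≤ (k : ℤ) - 1)
    (ha : a ∈ uL k N) (hlt : uHt k l < uHt k a) : a 0 = k ∧ 0 ≤ a 1 ∧ a 1 + 1 ≤ l 1 := by
  have hk' : (1 : ℤ) ≤ k := by exact_mod_cast hk
  have : uHt k l = 4 * k - 1 - l 1 := by
    unfold uHt; rw [if_neg (by omega), if_neg (by omega)]
  rw [this] at hlt
  rw [mem_uL_iff hk hkN] at ha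
  unfold uHt at hlt; split_ifs at hlt <;> omega

/-! ### Continuation steps -/

section Steps

variable {S P₀ ω P : Set (Site 2)} {l y i₀ : Site 2}

/-- **Continuation along a kind-A crossing.** From a junction in `(P ∩ I) ∪ high` already
reached from `i₀` by an `ω`-open path of `U ∪ I`, walking inside `P` to `j` either yields a site
of `S` joined to `i₀` by an `ω`-open path of `U ∪ I`, or extends the open path to `j` and shows
`j ∈ I` or `j` high. [cite: Nolin2008, §4.4, proof of Lemma 15 (arXiv 0711.4948: Lemma 14)] -/
theorem uStepA (hk : 1 ≤ k) (hkN : k + 1 ≤ N) (hSU : S ⊆ ↑(uSites k N)) (hSω : S ⊆ ω)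
    (hP₀ : P₀ ⊆ uLow k N S ∪ S) (honly : ∀ z ∈ S, z ∈ uL k N → z = l) (hl : l ∈ uL k N)
    (hy : y ∈ uR k N) (hpγ : PathIn triGraph S l y)
    (hPξ : P ⊆ ω ∪ (P₀ ∪ ((↑(uSites k N) : Set (Site 2)) ∪ uInner k)ᶜ))
    (hParc : ∀ b ∈ P, b ∈ uL k N → uHt k l < uHt k b)
    (hPI : ∀ a ∈ P, a ∈ uInner k → ∀ b ∈ P, triGraph.Adj a b →
      b ∈ (↑(uSites k N) : Set (Site 2)) ∨ b ∈ uInner k)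
    (hfake : ∀ a ∈ P, ∀ b ∈ P, triGraph.Adj a b → b ∉ (↑(uSites k N) : Set (Site 2)) → b ∉ uInner k →
      a ∈ (↑(uSites k N) : Set (Site 2)) → a ∈ uLow k N S ∨ a ∈ S)
    {a j : Site 2} (ha : a ∈ (P ∩ uInner k) ∪ uHigh k N S)
    (hacc : PathIn triGraph (ω ∩ (↑(uSites k N) ∪ uInner k)) i₀ a) (hp : PathIn triGraph P a j) :
    (∃ g ∈ S, PathIn triGraph (ω ∩ (↑(uSites k N) ∪ uInner k)) i₀ g) ∨
      (PathIn triGraph (ω ∩ (↑(uSites k N) ∪ uInner k)) i₀ j ∧ (j ∈ uInner k ∨ j ∈ uHigh k N S)) := by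
  rcases uPiece_beyond hk hkN hSU honly hl hy hpγ hParc hPI hfake ha hp with h | ⟨a', g, hgS, -, hag, h⟩
  · right
    refine ⟨hacc.trans (h.mono (pieceA_subset_open hSU hP₀ hPξ)), ?_⟩
    rcases h.right_mem.2 with ⟨-, hjI⟩ | hjH
    · exact Or.inl hjI
    · exact Or.inr hjH
  · left
    exact ⟨g, hgS, (hacc.trans (h.mono (pieceA_subset_open hSU hP₀ hPξ))).tail hag
      ⟨hSω hgS, Or.inl (hSU hgS)⟩⟩

/-- **Continuation along a kind-B crossing.** The same from a high junction, for a crossing no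
site of which inside `I` is adjacent to an arc site beyond the tip; the new junction is high. [cite: Nolin2008, §4.4, proof of Lemma 15 (arXiv 0711.4948: Lemma 14)] -/
theorem uStepB (hk : 1 ≤ k) (hkN : k + 1 ≤ N) (hSU : S ⊆ ↑(uSites k N)) (hSω : S ⊆ ω)
    (hP₀ : P₀ ⊆ uLow k N S ∪ S) (honly : ∀ z ∈ S, z ∈ uL k N → z = l) (hl : l ∈ uL k N) (hlS : l ∈ S)
    (hPξ : P ⊆ ω ∪ (P₀ ∪ ((↑(uSites k N) : Set (Site 2)) ∪ uInner k)ᶜ))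
    (hBI : ∀ a ∈ uL k N, uHt k l < uHt k a → ∀ b ∈ P, b ∈ uInner k → ¬ triGraph.Adj a b)
    (hfake : ∀ a ∈ P, ∀ b ∈ P, triGraph.Adj a b → b ∉ (↑(uSites k N) : Set (Site 2)) → b ∉ uInner k →
      a ∈ (↑(uSites k N) : Set (Site 2)) → a ∈ uLow k N S ∨ a ∈ S)
    {a j : Site 2} (ha : a ∈ uHigh k N S)
    (hacc : PathIn triGraph (ω ∩ (↑(uSites k N) ∪ uInner k)) i₀ a) (hp : PathIn triGraph P a j) :
    (∃ g ∈ S, PathIn triGraph (ω ∩ (↑(uSites k N) ∪ uInner k)) i₀ g) ∨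
      (PathIn triGraph (ω ∩ (↑(uSites k N) ∪ uInner k)) i₀ j ∧ j ∈ uHigh k N S) := by
  rcases uPiece_high hk hkN honly hl hlS hBI hfake ha hp with h | ⟨a', g, hgS, -, hag, h⟩
  · right
    exact ⟨hacc.trans (h.mono (pieceB_subset_open hSU hP₀ hPξ)), h.right_mem.2⟩
  · left
    exact ⟨g, hgS, (hacc.trans (h.mono (pieceB_subset_open hSU hP₀ hPξ))).tail hag
      ⟨hSω hgS, Or.inl (hSU hgS)⟩⟩

end Steps

end Literature.Probability.Percolation
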